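import Literature.NumberTheory.EllipticCurves.MordellCurveCubicDescentLocal
import Mathlib.Topology.Algebra.Valued.ValuationTopology
import HarnessLib

/-!
# Residue characters extend from a valued field to a dense overfield (the completion)

Topic `NumberTheory/EllipticCurves`. Companion of `MordellCurveCubicDescentLocal.lean`, whose
level-one residue characters `MordellDescent.IsResidueChar v χ` (`χ : L → ℤ/3ℤ` multiplicative on
`Lˣ`, constant on the balls `{y : v(y − x) < v(x)}`, killing `−1` — the shape of the cubic residue
character of the unit part at an inert prime) express the local condition of the `√−3`-descent on
`Y² = X³ + B²` at such a prime (`IsResidueChar.apply_cubicDescent_eq_zero`). Those characters are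
built in the tree on the GLOBAL field `K = ℚ(ζ₃)` (`EisensteinFieldLocal.lean`: `K3.chi`). To impose
the condition on `Ш` — on Selmer classes rather than on images of global points — one needs the
character on the COMPLETION `K_v`, where the local points live. This file performs the extension
once and for all, for any field `K` with a `ℤᵐ⁰`-valued valuation `vK`, any valued field `L ⊇ K`
in which `K` is dense and whose valuation restricts to `vK` (Mathlib: `v.adicCompletion K` with
`valuedAdicCompletion_eq_valuation'`, `denseRange_algebraMap`):

* `MordellDescent.exists_approx`: every `x ∈ Lˣ` has a `K`-approximation `y` with
  `v(y − x) < v(x)` (the ball is a neighbourhood of `x`, as in Mathlib's `Valued.locally_const`,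
  and `K` is dense);
* `MordellDescent.IsResidueChar.apply_eq_of_approx`: `χ` takes the same value on all
  `K`-approximations of `x`;
* **`MordellDescent.IsResidueChar.exists_isResidueChar_extension`**: there is a level-one residue
  character `χ_L` of `L` (for the valuation of `L`) with `χ_L ∘ (K → L) = χ` — namely
  `x ↦ χ(y)` for any approximation `y` of `x`.

This is the elementary content of "the residue field of the completion is the residue field"
(Neukirch, *Algebraic Number Theory*, II.4.3) in the form needed here: a function on `Kˣ` that is
locally constant for the `v`-adic topology in the strong sense above extends uniquely to `Lˣ`.

## References

* J. Neukirch, *Algebraic Number Theory*, Grundlehren 322 (1999), Ch. II, Prop. 4.3 (`𝓞/𝔭 ≅ 𝓞̂/𝔭̂`).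
  [NeukirchANT1999]
* J. H. Silverman, *The Arithmetic of Elliptic Curves*, 2nd ed., GTM 106 (2009), X.4 (local
  conditions of Selmer groups are conditions in the completions). [SilvermanAEC2009]
-/

noncomputable section

open scoped Classical WithZero
open Topology

namespace Literature.NumberTheory.EllipticCurves

namespace MordellDescent

variable {K : Type*} [Field K] (vK : Valuation K ℤᵐ⁰)
variable {L : Type*} [Field L] [Algebra K L] [hL : Valued L ℤᵐ⁰]

/-- The open ball `{z : v(z − x) < v(x)}` around `x ∈ Lˣ` is a neighbourhood of `x` (cf. Mathlib's
`Valued.locally_const`). [cite: NeukirchANT1999, Ch. II Prop. 4.3] -/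
theorem ball_mem_nhds {x : L} (hx : x ≠ 0) : {z : L | Valued.v (z - x) < Valued.v x} ∈ 𝓝 x := by
  rw [Valued.mem_nhds]
  have h : (Valued.v x : ℤᵐ⁰) ≠ 0 := (Valuation.ne_zero_iff _).mpr hx
  have h' : Valued.v.restrict x ≠ 0 := by simpa using hx
  refine ⟨Units.mk0 _ h', ?_⟩
  rw [Units.val_mk0]
  intro y hy
  exact Valued.v.restrict_lt_iff.mp hy

/-- **Approximation from the dense subfield**: if `K` is dense in `L`, every `x ∈ Lˣ` has `y ∈ K`
with `v(y − x) < v(x)`. [cite: NeukirchANT1999, Ch. II Prop. 4.3] -/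
theorem exists_approx (hdense : DenseRange (algebraMap K L)) {x : L} (hx : x ≠ 0) :
    ∃ y : K, Valued.v (algebraMap K L y - x) < Valued.v x := by
  obtain ⟨z, ⟨y, rfl⟩, hz⟩ := hdense.inter_nhds_nonempty (ball_mem_nhds hx)
  exact ⟨y, hz⟩

namespace IsResidueChar

variable {vK} {χ : K → ZMod 3} (hχ : IsResidueChar vK χ)
variable (hv : ∀ y : K, Valued.v (algebraMap K L y) = vK y)
include hχ hv

/-- **`χ` is constant on the `K`-points of a ball**: two `K`-approximations of the same `x ∈ Lˣ`
have the same `χ` (`v(y₂ − y₁) ≤ max(v(y₂ − x), v(y₁ − x)) < v(x) = v(y₁)`).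
[cite: NeukirchANT1999, Ch. II Prop. 4.3] -/
theorem apply_eq_of_approx {x : L} {y₁ y₂ : K} (h₁ : Valued.v (algebraMap K L y₁ - x) < Valued.v x)
    (h₂ : Valued.v (algebraMap K L y₂ - x) < Valued.v x) : χ y₂ = χ y₁ := by
  apply hχ.eq_of_lt
  have hx1 : Valued.v (algebraMap K L y₁) = Valued.v x := Valuation.map_eq_of_sub_lt _ h₁
  rw [← hv, ← hv, map_sub, hx1]
  calc Valued.v (algebraMap K L y₂ - algebraMap K L y₁)
      = Valued.v ((algebraMap K L y₂ - x) - (algebraMap K L y₁ - x)) := by ring_nf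
    _ ≤ max (Valued.v (algebraMap K L y₂ - x)) (Valued.v (algebraMap K L y₁ - x)) :=
        Valuation.map_sub _ _ _
    _ < Valued.v x := max_lt h₂ h₁

/-- **Residue characters extend to a dense valued overfield.** If `K` is dense in `L` and the
valuation of `L` restricts to `vK`, a level-one residue character `χ` of `(K, vK)` extends to a
level-one residue character `χ_L` of `L` (multiplicative on `Lˣ`, constant on the balls
`{y : v(y − x) < v(x)}`, killing `−1`) with `χ_L ∘ (K → L) = χ`: put `χ_L(x) = χ(y)` for any
`K`-approximation `y` of `x` (well defined by `apply_eq_of_approx`; approximations multiply,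
`v(y₁y₂ − x₁x₂) < v(x₁x₂)`, and an approximation of `y` is one of `x` when `v(y − x) < v(x)`).
The elementary content of "the residue field of the completion is the residue field".
[cite: NeukirchANT1999, Ch. II Prop. 4.3] -/
theorem exists_isResidueChar_extension (hdense : DenseRange (algebraMap K L)) :
    ∃ χL : L → ZMod 3, IsResidueChar (hL.v) χL ∧ ∀ y : K, χL (algebraMap K L y) = χ y := by
  -- the extension and its evaluation through approximations
  set χL : L → ZMod 3 := fun x =>
    if h : ∃ y : K, Valued.v (algebraMap K L y - x) < Valued.v x then χ (Classical.choose h) else χ 0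
    with hχL
  have hext : ∀ {x : L} {y : K}, Valued.v (algebraMap K L y - x) < Valued.v x → χL x = χ y := by
    intro x y h
    have hex : ∃ y : K, Valued.v (algebraMap K L y - x) < Valued.v x := ⟨y, h⟩
    simp only [hχL]
    rw [dif_pos hex]
    exact hχ.apply_eq_of_approx hv h (Classical.choose_spec hex)
  have halg : ∀ y : K, χL (algebraMap K L y) = χ y := by
    intro y
    by_cases hy : y = 0
    · rw [hy, map_zero]
      simp only [hχL]
      rw [dif_neg]
      rintro ⟨z, hz⟩
      rw [sub_zero, map_zero] at hz
      exact not_lt_zero hz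
    · apply hext
      rw [sub_self, map_zero]
      exact (Valuation.pos_iff _).mpr ((map_ne_zero _).mpr hy)
  refine ⟨χL, ⟨?_, ?_, ?_⟩, halg⟩
  · -- multiplicativity: approximations multiply
    intro x₁ x₂ hx₁ hx₂
    obtain ⟨y₁, h₁⟩ := exists_approx hdense hx₁
    obtain ⟨y₂, h₂⟩ := exists_approx hdense hx₂
    have hv1 : Valued.v (algebraMap K L y₁) = Valued.v x₁ := Valuation.map_eq_of_sub_lt _ h₁
    have hy₁ : y₁ ≠ 0 := by
      rintro rfl
      rw [map_zero, map_zero, eq_comm, Valuation.zero_iff] at hv1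
      exact hx₁ hv1
    have hy₂ : y₂ ≠ 0 := by
      rintro rfl
      have hv2 : Valued.v (algebraMap K L 0) = Valued.v x₂ := Valuation.map_eq_of_sub_lt _ h₂
      rw [map_zero, map_zero, eq_comm, Valuation.zero_iff] at hv2
      exact hx₂ hv2
    have h12 : Valued.v (algebraMap K L (y₁ * y₂) - x₁ * x₂) < Valued.v (x₁ * x₂) := by
      have hx₂0 : (0 : ℤᵐ⁰) < Valued.v x₂ := (Valuation.pos_iff _).mpr hx₂
      have hx₁0 : (0 : ℤᵐ⁰) < Valued.v x₁ := (Valuation.pos_iff _).mpr hx₁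
      rw [(algebraMap K L).map_mul, show algebraMap K L y₁ * algebraMap K L y₂ - x₁ * x₂ =
        algebraMap K L y₁ * (algebraMap K L y₂ - x₂) + x₂ * (algebraMap K L y₁ - x₁) by ring]
      calc Valued.v (algebraMap K L y₁ * (algebraMap K L y₂ - x₂) + x₂ * (algebraMap K L y₁ - x₁))
          ≤ max (Valued.v (algebraMap K L y₁ * (algebraMap K L y₂ - x₂)))
              (Valued.v (x₂ * (algebraMap K L y₁ - x₁))) := Valuation.map_add _ _ _
        _ < Valued.v (x₁ * x₂) := by
            rw [Valuation.map_mul, Valuation.map_mul, Valuation.map_mul, hv1]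
            apply max_lt
            · exact mul_lt_mul_of_pos_left h₂ hx₁0
            · rw [mul_comm (Valued.v x₁) (Valued.v x₂)]
              exact mul_lt_mul_of_pos_left h₁ hx₂0
    rw [hext h12, hext h₁, hext h₂]
    exact hχ.map_mul hy₁ hy₂
  · -- local constancy: an approximation of `y` is one of `x`
    intro x y hyx
    have hx : x ≠ 0 := by
      intro hx
      rw [hx, map_zero] at hyx
      exact not_lt_zero hyx
    have hvy : Valued.v y = Valued.v x := Valuation.map_eq_of_sub_lt _ hyx
    have hy : y ≠ 0 := by
      intro hy
      rw [hy, map_zero, eq_comm, Valuation.zero_iff] at hvy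
      exact hx hvy
    obtain ⟨y', hy'⟩ := exists_approx hdense hy
    have hx' : Valued.v (algebraMap K L y' - x) < Valued.v x := by
      rw [show algebraMap K L y' - x = (algebraMap K L y' - y) + (y - x) by ring]
      calc Valued.v ((algebraMap K L y' - y) + (y - x))
          ≤ max (Valued.v (algebraMap K L y' - y)) (Valued.v (y - x)) := Valuation.map_add _ _ _
        _ < Valued.v x := max_lt (hvy ▸ hy') hyx
    rw [hext hy', hext hx']
  · -- `−1 ∈ K`
    have h := halg (-1)
    rw [(algebraMap K L).map_neg, (algebraMap K L).map_one] at h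
    rw [h]
    exact hχ.map_neg_one

end IsResidueChar

end MordellDescent

end Literature.NumberTheory.EllipticCurves
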